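import Summits.CriticalPhenomena.PercolationContinuityZ3.Theorems.Transplant.AutCylinderNilpotent
import Summits.CriticalPhenomena.PercolationContinuityZ3.Theorems.Transplant.AutChartTreeSkeleton
import Summits.CriticalPhenomena.PercolationContinuityZ3.Theorems.Transplant.PlanarSkeletonFrmQuasiProxies
import HarnessLib

/-!
# Φ2 for class C2 by induction on the growth degree, part V — ASSEMBLY: the (N3-b) node in its CARRIER FORM (over `PlanarSkeletonFrmQuasi` with proxies and the
# cylinder hypothesis `hC`), composed with the refuter's tree-chart adapter, IS the end-state node with the cylinder hypothesis; hence that ONE node statement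
# gives Conjecture 4 on every quasi-transitive graph of polynomial growth (mod Trofimov) and on every Cayley graph of every virtually nilpotent group of polynomial
# growth (no named fact).  The rung's statement is thereby fixed at both ends.

builds on p205010 (kernel theorem, internal audit signed; external expert review pending) — nothing in this file uses p205010; NOTHING is claimed about any open node:
every percolation conclusion here is CONDITIONAL on the hypothesis `hNode` written out in §3 — the quasi-step node over the carrier, NOT in the tree (its name and
wording are the lead's).  Lane `prim-bschramm`, seat `prim-bschramm-p3` gen 29 (DESIGN OWNER).  Helper file (`--supports stmt-CriticalPhenomena-4575 --as helper`).

THE CHAIN.  INPUT of the node = `PlanarSkeletonFrmQuasi G` («PlanarSkeletonFrmQuasiDefs» p507026) + `HasProxies t Dp` («PlanarSkeletonFrmQuasiProxies» p508543) +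
`CylSubcritical (p_c t)`; OUTPUT = `θ_t(p_c) = 0`.  §1: the refuter's adapter «AutChartTreeSkeleton» (p508374: `TreeDatum.skeleton`) HAS proxies at every vertex
(`hasProxies_skeleton`, from `exists_coarse_proxies`).  §2: the carrier's cylinders (coarse boxes) are FINE boxes of the equivariant fine tree chart
(`coarse_cyl_eq_chart_mem`), and the fine chart has rank two (`det2` of the two axis-edge values is `Δ² ≠ 0`).  §3: **`endStateCyl_of_frmQuasiNode`** — the node
in carrier form ⟹ the end-state node with the cylinder hypothesis (the `hN` of parts II/IV): on exponential growth Hutchcroft; off it the tree-chart carrier, proxies,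
`hC` from the hypothesis on fine-box cylinders (with `p_c(t′) = p_c(t)` by connectedness), and the frame of `x`.  §4: **`conj4_polynomialGrowth_of_frmQuasiNode (hT) (hNode)`**,
**`conj4_cayley_virtuallyNilpotent_of_frmQuasiNode (hNode)`** (no named fact), `heisenberg_of_frmQuasiNode`.
[cite: BenjaminiSchramm1996, Conj. 4; §2 (almost transitive graphs; Cayley graphs)] [cite: KozmaNitzan2024, §4 p. 16 (Lemma 8)] [cite: Hutchcroft2016, Thm. 1.1]
[cite: Trofimov1985, Thm. 2]
-/

noncomputable section

namespace Summit.CriticalPhenomena.PercolationContinuityZ3.Theorems.Transplant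

namespace AutCyl

open SimpleGraph Literature.Barriers.CriticalPhenomena Literature.Probability.LatticeModels Literature.Probability.Percolation
open Literature.Combinatorics.SimpleGraph (Trofimov1985_polynomialGrowthBlocks)
open scoped Classical

variable {V : Type} {G : SimpleGraph V} {A : Type} [Group A] [MulAction A V]

/-! ## §1 The tree-chart carrier has proxies at every vertex -/

/-- **The adapter's carrier has proxies** (the `HasProxies` of «PlanarSkeletonFrmQuasiProxies») at EVERY vertex, at one radius. [folklore] -/
theorem hasProxies_skeleton [G.LocallyFinite] (D : AutChart.TreeDatum G A) (hc : G.Connected) {m : ℕ}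
    (hker : ∀ r ∈ D.reps, ∀ k : A, D.c k = 1 → k ∈ Subgroup.closure {g : A | D.c g = 1 ∧ g • r ∈ graphBall G r m}) :
    ∃ Dp : ℕ, ∀ t : V, (D.skeleton hc hker).HasProxies t Dp := by
  obtain ⟨Dp, hDp⟩ := D.exists_coarse_proxies hc
  refine ⟨Dp, fun t c => ?_⟩
  obtain ⟨c', g, hgt, htr, hcc, hball⟩ := hDp t c
  exact ⟨c', smulIso D.act g, by rw [smulIso_apply, hgt], fun w => by rw [smulIso_apply]; exact htr w, hcc, hball⟩

/-! ## §2 Coarse cylinders are fine boxes; the fine tree chart has rank two -/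

/-- The fine box of chart values over the coarse box of half-width `ℓ` at `t`. [folklore] -/
def fineBox [G.LocallyFinite] (D : AutChart.TreeDatum G A) (t : V) (ℓ : ℕ) : Finset (Site 2) :=
  Fintype.piFinset fun j => Finset.Icc ((D.N : ℤ) * (D.coarse t j - ℓ)) ((D.N : ℤ) * (D.coarse t j + ℓ + 1) - 1)

/-- **Coarse cylinders are fine boxes**: `coarse w − coarse t ∈ box ℓ ⟺ chart w ∈ fineBox t ℓ`. [folklore] -/
theorem coarse_cyl_iff_chart_mem [G.LocallyFinite] (D : AutChart.TreeDatum G A) (t : V) (ℓ : ℕ) (w : V) :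
    D.coarse w - D.coarse t ∈ box 2 ℓ ↔ D.chart w ∈ (fineBox D t ℓ : Set (Site 2)) := by
  have hN := D.N_pos
  rw [mem_box, Finset.mem_coe, fineBox, Fintype.mem_piFinset]
  refine forall_congr' fun j => ?_
  rw [Finset.mem_Icc, Pi.sub_apply, AutChart.TreeDatum.coarse_apply, AutChart.TreeDatum.coarse_apply]
  set x := D.chart w j
  set c := D.chart t j / (D.N : ℤ)
  constructor
  · rintro ⟨h1, h2⟩
    constructor
    · have : c - ℓ ≤ x / (D.N : ℤ) := by linarith
      have := (Int.le_ediv_iff_mul_le hN).1 this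
      linarith [mul_comm ((c : ℤ) - ℓ) (D.N : ℤ)]
    · have : x / (D.N : ℤ) < c + ℓ + 1 := by linarith
      have := (Int.ediv_lt_iff_lt_mul hN).1 this
      linarith [mul_comm ((c : ℤ) + ℓ + 1) (D.N : ℤ)]
  · rintro ⟨h1, h2⟩
    constructor
    · have : c - ℓ ≤ x / (D.N : ℤ) := (Int.le_ediv_iff_mul_le hN).2 (by linarith [mul_comm ((c : ℤ) - ℓ) (D.N : ℤ)])
      linarith
    · have : x / (D.N : ℤ) < c + ℓ + 1 := (Int.ediv_lt_iff_lt_mul hN).2 (by linarith [mul_comm ((c : ℤ) + ℓ + 1) (D.N : ℤ)])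
      linarith

/-- The set identity of the previous lemma. [folklore] -/
theorem coarse_cyl_eq_chart_mem [G.LocallyFinite] (D : AutChart.TreeDatum G A) (t : V) (ℓ : ℕ) :
    {w | D.coarse w - D.coarse t ∈ box 2 ℓ} = {w | D.chart w ∈ (fineBox D t ℓ : Set (Site 2))} :=
  Set.ext fun w => coarse_cyl_iff_chart_mem D t ℓ w

/-- The base vertex's chart value lies in its fine box. [folklore] -/
theorem chart_mem_fineBox [G.LocallyFinite] (D : AutChart.TreeDatum G A) (t : V) (ℓ : ℕ) : D.chart t ∈ (fineBox D t ℓ : Set (Site 2)) := by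
  rw [← coarse_cyl_iff_chart_mem, sub_self]; exact zero_mem_box 2 ℓ

/-- **The fine tree chart has rank two**: the two axis edges carry values `Δ e₀`, `Δ e₁`, of determinant `Δ² ≠ 0`. [folklore] -/
theorem exists_det2_ne_zero (D : AutChart.TreeDatum G A) :
    ∃ a b : A, MaxArea.det2 (Multiplicative.toAdd (D.c a)) (Multiplicative.toAdd (D.c b)) ≠ 0 := by
  obtain ⟨r₀, -, n₀, -, h₀⟩ := D.axis 0 1
  obtain ⟨r₁, -, n₁, -, h₁⟩ := D.axis 1 1
  refine ⟨AutChart.osec D.cover n₀, AutChart.osec D.cover n₁, ?_⟩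
  have e₀ : Multiplicative.toAdd (D.c (AutChart.osec D.cover n₀)) = Pi.single 0 (D.Δ : ℤ) := by
    rw [← D.chart_eq_toAdd_osec, D.chart_eq, h₀, Units.val_one, mul_one]
  have e₁ : Multiplicative.toAdd (D.c (AutChart.osec D.cover n₁)) = Pi.single 1 (D.Δ : ℤ) := by
    rw [← D.chart_eq_toAdd_osec, D.chart_eq, h₁, Units.val_one, mul_one]
  rw [e₀, e₁, MaxArea.det2]
  have hΔ : (D.Δ : ℤ) ≠ 0 := by have := D.one_le_Δ; omega
  simp only [Pi.single_eq_same, Pi.single_eq_of_ne (show (1 : Fin 2) ≠ 0 by decide), Pi.single_eq_of_ne (show (0 : Fin 2) ≠ 1 by decide),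
    mul_zero, sub_zero]
  exact mul_ne_zero hΔ hΔ

/-! ## §3 The node in carrier form implies the end-state node with the cylinder hypothesis -/

/-- `θ` on an induced subgraph depends only on the inducing set. [folklore] -/
private theorem theta_induce_congr_set {W : Type} [Countable W] (G : SimpleGraph W) {S T : Set W} (h : S = T) {t : W} (hS : t ∈ S) (hT : t ∈ T)
    (p : unitInterval) : theta (G.induce S) ⟨t, hS⟩ p = theta (G.induce T) ⟨t, hT⟩ p := by
  subst h; rfl

/-- **THE ASSEMBLY.**  ASSUME the quasi-step node in CARRIER FORM (`hNode`: on a connected locally finite graph, a `PlanarSkeletonFrmQuasi` with proxies at the type `t`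
and subcritical cylinders at `p_c(t)` gives `θ_t(p_c) = 0` — the statement the GEN wave is to deliver).  THEN the end-state node WITH the cylinder hypothesis holds:
for `A₀ ≤ Aut(G)` with finitely many orbits and a rank-two character killing the stabilisers, if every fine-box cylinder of every `A₀`-equivariant rank-two chart is
subcritical at `p_c`, then `θ_x(p_c) = 0` everywhere.  (Exponential growth: Hutchcroft.  Otherwise: the tree-chart carrier of the adapter, its proxies, its cylinders =
fine boxes of the equivariant fine chart, `p_c(t′) = p_c(t)`, and the frame of `x`.) [cite: BenjaminiSchramm1996, Conj. 4; §2] [cite: Hutchcroft2016, Thm. 1.1]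
[cite: KozmaNitzan2024, §4 p. 16 (Lemma 8)] -/
theorem endStateCyl_of_frmQuasiNode
    (hNode : ∀ {W : Type} (G : SimpleGraph W) [G.LocallyFinite], G.Connected → ∀ (Φ : PlanarSkeletonFrmQuasi G) (t : W), t ∈ Φ.types →
      ∀ Dp : ℕ, Φ.HasProxies t Dp → Φ.CylSubcritical (criticalProbIOf G t) → theta G t (criticalProbIOf G t) = 0)
    {W : Type} (G : SimpleGraph W) [G.LocallyFinite] (hc : G.Connected) (A₀ : Subgroup (G ≃g G)) (reps : Finset W) (c : A₀ →* Multiplicative (Site 2))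
    (horb : ∀ w : W, ∃ a : A₀, ∃ s ∈ reps, (a : G ≃g G) s = w) (hstab : ∀ (a : A₀) (w : W), (a : G ≃g G) w = w → c a = 1)
    (hrank : ∃ a b : A₀, MaxArea.det2 (Multiplicative.toAdd (c a)) (Multiplicative.toAdd (c b)) ≠ 0)
    (HC : ∀ (χ : W → Site 2) (τ : A₀ → Site 2), (∀ (a : A₀) (w : W), χ ((a : G ≃g G) w) = τ a + χ w) →
      (∃ a b : A₀, MaxArea.det2 (τ a) (τ b) ≠ 0) →
      ∀ (B : Finset (Site 2)) (r : W) (hr : χ r ∈ B), theta (G.induce {w | χ w ∈ (B : Set (Site 2))}) ⟨r, hr⟩ (criticalProbIOf G r) = 0)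
    (x : W) : theta G x (criticalProbIOf G x) = 0 := by
  haveI : Countable W := countable_of_connected_of_locallyFinite G hc x
  have hact : IsActionByAut G A₀ := fun a y z => (a : G ≃g G).map_rel_iff'
  have horb' : ∀ w : W, ∃ a : A₀, ∃ s ∈ reps, a • s = w := fun w => by
    obtain ⟨a, s, hs, hw⟩ := horb w; exact ⟨a, s, hs, hw⟩
  have hq : IsQuasiTransitive G := AutChart.isQuasiTransitive_of_finite_orbits hact reps horb'
  by_cases hG : HasExponentialGrowth G
  · exact Hutchcroft2016_noPercolationAtCriticality_holds G hc hq hG x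
  -- the tree-chart carrier
  obtain ⟨a₀, t₀, -, -⟩ := horb' x
  have hstab₀ : ∀ h ∈ MulAction.stabilizer A₀ t₀, c h = 1 := fun h hh => hstab h t₀ (MulAction.mem_stabilizer_iff.1 hh)
  obtain ⟨D, m, hker, -, -, -, -⟩ := AutChart.TreeDatum.exists_skeleton hact hc reps horb' c hstab₀ hrank hG
  set Φ := D.skeleton hc hker with hΦ
  obtain ⟨Dp, hprox⟩ := hasProxies_skeleton D hc hker
  -- the type of `x`
  obtain ⟨t, ht, α, hαt, -⟩ := Φ.frame x
  have hbase : theta G t (criticalProbIOf G t) = 0 := by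
    refine hNode G hc Φ t ht Dp (hprox t) fun t' _ ℓ => ?_
    -- the coarse cylinder at `t'` is a fine box of the equivariant fine chart
    have hset : Φ.cyl t' ℓ = {w | D.chart w ∈ (fineBox D t' ℓ : Set (Site 2))} := by
      rw [hΦ, AutChart.TreeDatum.skeleton_cyl]; exact coarse_cyl_eq_chart_mem D t' ℓ
    have hmem : D.chart t' ∈ (fineBox D t' ℓ : Set (Site 2)) := chart_mem_fineBox D t' ℓ
    have h1 := HC D.chart (fun a => Multiplicative.toAdd (D.c a)) (fun a w => D.chart_smul a w) (exists_det2_ne_zero D) (fineBox D t' ℓ) t' hmem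
    have hpc : criticalProbIOf G t' = criticalProbIOf G t := Subtype.ext (criticalProb_eq_of_reachable G (hc.preconnected t' t))
    rw [hpc] at h1
    have hmemS : t' ∈ Φ.cyl t' ℓ := by
      show Φ.φ t' - Φ.φ t' ∈ box 2 ℓ
      rw [sub_self]; exact zero_mem_box 2 ℓ
    rw [theta_induce_congr_set G hset hmemS hmem]
    exact h1
  -- transport to `x` along the frame
  have hθ := theta_iso α t (criticalProbIOf G t)
  have hpcx := criticalProb_iso α t
  rw [hαt] at hθ hpcx
  have e : criticalProbIOf G x = criticalProbIOf G t := Subtype.ext hpcx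
  rw [e, hθ]
  exact hbase

/-! ## §4 What the node in carrier form buys -/

/-- **The node in carrier form + Trofimov ⟹ Conjecture 4 on EVERY quasi-transitive graph of polynomial growth** (part II composed with §3).
[cite: BenjaminiSchramm1996, Conj. 4] [cite: Trofimov1985, Thm. 2] -/
theorem conj4_polynomialGrowth_of_frmQuasiNode (hT : Trofimov1985_polynomialGrowthBlocks)
    (hNode : ∀ {W : Type} (G : SimpleGraph W) [G.LocallyFinite], G.Connected → ∀ (Φ : PlanarSkeletonFrmQuasi G) (t : W), t ∈ Φ.types →
      ∀ Dp : ℕ, Φ.HasProxies t Dp → Φ.CylSubcritical (criticalProbIOf G t) → theta G t (criticalProbIOf G t) = 0) :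
    BenjaminiSchramm1996_conj4_polynomialGrowth :=
  conj4_polynomialGrowth_of_endStateCyl hT fun G _ hc A₀ reps c horb hstab hrank HC x =>
    endStateCyl_of_frmQuasiNode hNode G hc A₀ reps c horb hstab hrank HC x

/-- **The node in carrier form ⟹ Conjecture 4 on every Cayley graph of every finitely generated VIRTUALLY NILPOTENT group of polynomial growth — NO named fact**
(part IV composed with §3). [cite: BenjaminiSchramm1996, Conj. 4; §2 (Cayley graphs)] [cite: MilnorSolvableGrowth1968, Lemma 1] -/
theorem conj4_cayley_virtuallyNilpotent_of_frmQuasiNode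
    (hNode : ∀ {W : Type} (G : SimpleGraph W) [G.LocallyFinite], G.Connected → ∀ (Φ : PlanarSkeletonFrmQuasi G) (t : W), t ∈ Φ.types →
      ∀ Dp : ℕ, Φ.HasProxies t Dp → Φ.CylSubcritical (criticalProbIOf G t) → theta G t (criticalProbIOf G t) = 0)
    {Γ : Type} [Group Γ] (S : Finset Γ) (hS : Subgroup.closure (S : Set Γ) = ⊤) (N : Subgroup Γ) [N.FiniteIndex] [Group.IsNilpotent N]
    (hpoly : ∃ C D : ℝ, ∀ (g : Γ) (n : ℕ), (ballVolume (mulCayley (↑S : Set Γ)) g n : ℝ) ≤ C * ((n : ℝ) + 1) ^ D) (g : Γ)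
    (hpc : criticalProb (mulCayley (↑S : Set Γ)) g < 1) : theta (mulCayley (↑S : Set Γ)) g (criticalProbIOf (mulCayley (↑S : Set Γ)) g) = 0 :=
  conj4_cayley_virtuallyNilpotent_of_endStateCyl (fun G _ hc A₀ reps c horb hstab hrank HC x =>
    endStateCyl_of_frmQuasiNode hNode G hc A₀ reps c horb hstab hrank HC x) S hS N hpoly g hpc

/-- **… in particular the Heisenberg target** (mod Trofimov, through the polynomial-growth class). [cite: BenjaminiSchramm1996, Conj. 4] [cite: Trofimov1985, Thm. 2] -/
theorem heisenberg_of_frmQuasiNode (hT : Trofimov1985_polynomialGrowthBlocks)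
    (hNode : ∀ {W : Type} (G : SimpleGraph W) [G.LocallyFinite], G.Connected → ∀ (Φ : PlanarSkeletonFrmQuasi G) (t : W), t ∈ Φ.types →
      ∀ Dp : ℕ, Φ.HasProxies t Dp → Φ.CylSubcritical (criticalProbIOf G t) → theta G t (criticalProbIOf G t) = 0) :
    HeisenbergCriticalContinuity :=
  heisenbergCriticalContinuity_of_conj4_polynomialGrowth' (conj4_polynomialGrowth_of_frmQuasiNode hT hNode)

end AutCyl

end Summit.CriticalPhenomena.PercolationContinuityZ3.Theorems.Transplant

end
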